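import Mathlib
import Summits.BirchSwinnertonDyer.BirchSwinnertonDyer.Theorems.ManinLocalTwoThreeTwoDvdModularDegreeOfWtInvariant
import Summits.BirchSwinnertonDyer.BirchSwinnertonDyer.Theorems.ManinLocalTwoThreeCuspThreeTorsionAtFour
import Summits.BirchSwinnertonDyer.Rank1Residual.ManinAdditive.OddDegreeTooth
import HarnessLib

/-!
# ODD DEGREE ⟹ THE QUARTER SYMBOL IS NOT A PERIOD at level `4p` (any curve, any datum); `OddDegreeForcesQuarterSymbol` BY NAME

Summit `BirchSwinnertonDyer`, sub-problem `BirchSwinnertonDyer`, route `ManinLocalTwoThree`; width seat `bsd-line-manin23-p2`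
(gen 9), `--supports` the crux C2 `ManinOddAtFour` (stmt-BirchSwinnertonDyer-22967).  Cell `bsd-f2-manin`, an lens leaf
`…ManinAdditive.OddDegreeTooth` (an g17, MEMO-an §61): the named implication `OddDegreeForcesQuarterSymbol :
FourPBlindFamilyOddDegree → FourPBlindFamilyQuarterSymbol` («NOT kernel-proved: the tree has no `w_Q`-functional equation for
`φ`»; Yazdani 2011 Lemmas 2.3–2.5, which also need `λ_p = +1`).  PROVED here for EVERY elliptic curve and EVERY
`X₀(4p)`-parametrisation datum, `p` odd, WITHOUT any Atkin–Lehner sign input: if `{∞, 1/4}_f ∈ Λ_f` then the cusp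
`w(p)∞ = x/4 ∼ 1/4` maps to `O`, and `2 ∣ deg φ` by the seat's two involutions of `Y₀(4p)` — `w(p)` when `w_p f = +f`,
`w(p)·t` when `w_p f = −f` (`two_dvd_modularDegree_of_cusp_atkinLehnerW_eq_zero`).

PROVED here (no `sorry`): `modularSymbol_atkinLehnerCusp_sub_quarter_mem` (`{∞, x/4}_f ≡ {∞, 1/4}_f (mod Λ_f)` at level `4p`),
**`two_dvd_deg_of_quarterSymbol_mem`**, **`quarterSymbol_not_mem_of_odd_deg`**,
**`oddDegreeForcesQuarterSymbol_holds : OddDegreeForcesQuarterSymbol`** (BY NAME; the family hypotheses are not used).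
BSD is not proved by this; Manin's conjecture is not proved by this.
-/

set_option autoImplicit false
set_option linter.dupNamespace false

noncomputable section

open scoped MatrixGroups ModularForm
open CongruenceSubgroup Matrix.SpecialLinearGroup UpperHalfPlane
open Literature.NumberTheory.EllipticCurves Literature.NumberTheory.EllipticCurves.ModularForms
open Summit.BirchSwinnertonDyer.Rank1Residual.ManinAdditive
open Summit.BirchSwinnertonDyer.Rank1Residual.ManinAdditive.OddDegreeTooth

namespace Summit.BirchSwinnertonDyer.BirchSwinnertonDyer.Theorems.ManinLocalTwoThree

/-- **The cusp `w(p)∞ = x/4` is `Γ₀(4p)`-equivalent to `1/4`** (`p` odd, `w(p) = (px, y; 4p, p)`, `px − 4y = 1`):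
`{∞, x/4}_f − {∞, 1/4}_f ∈ Λ_f`.  (`x` is odd; for `x ≡ 1 (4)` translate by `(x−1)/4`, for `x ≡ 3 (4)` use
`γ = (1 − 2px, b; −8p, 1 + 2p)`.) -/
theorem modularSymbol_atkinLehnerCusp_sub_quarter_mem {p : ℕ} [NeZero (4 * p)] (hp : Odd p)
    (f : CuspForm (Gamma0 (4 * p)) 2) :
    modularSymbol f ((atkinLehnerSL (4 * p) p 0 0 : ℚ) / (4 * p / p : ℕ)) - modularSymbol f (1 / 4 : ℚ) ∈
      periodLattice f := by
  obtain ⟨p', hp'⟩ := hp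
  have hp0 : 0 < p := by omega
  haveI : NeZero p := ⟨hp0.ne'⟩
  have hdiv : 4 * p / p = 4 := Nat.mul_div_cancel 4 hp0
  have hcop : Nat.Coprime p (4 * p / p) := by
    rw [hdiv]
    have h2 : Nat.Coprime p 2 := (Nat.coprime_comm.mp (Nat.prime_two.coprime_iff_not_dvd.mpr (by omega)))
    simpa using h2.pow_right 2
  set x : ℤ := atkinLehnerSL (4 * p) p 0 0 with hx
  set y : ℤ := atkinLehnerSL (4 * p) p 0 1 with hy
  have hbez : (p : ℤ) * x - 4 * y = 1 := by
    have h := atkinLehnerSL_bezout (4 * p) p hcop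
    rw [hdiv] at h
    exact_mod_cast h
  have hN : ((4 * p : ℕ) : ℤ) = 4 * (p : ℤ) := by push_cast; ring
  have q4 : (1 / 4 : ℚ) = ((1 : ℤ) : ℚ) / ((4 : ℤ) : ℚ) := by norm_num
  have qx : ((x : ℚ) / (4 * p / p : ℕ)) = ((x : ℤ) : ℚ) / ((4 : ℤ) : ℚ) := by rw [hdiv]; push_cast; ring
  rw [q4, qx]
  -- `x` is odd: `x = 4t + 1` or `x = 4t + 3`
  have hpx : Odd ((p : ℤ) * x) := ⟨2 * y, by linear_combination hbez⟩
  have hxodd : Odd x := (Int.odd_mul.mp hpx).2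
  have hx4 : x % 4 = 1 ∨ x % 4 = 3 := by
    obtain ⟨r, hr⟩ := hxodd; omega
  rcases hx4 with h1 | h3
  · -- translation by `t = (x - 1)/4`
    obtain ⟨t, ht⟩ : ∃ t : ℤ, x = 4 * t + 1 := ⟨x / 4, by omega⟩
    exact modularSymbol_div_sub_div_mem_periodLattice f (a := 1) (b := t) (c := 0) (d := 1) (by ring)
      ⟨0, by ring⟩ 1 4 x 4 (by norm_num) (by norm_num) (by norm_num) (by rw [ht]; ring)
  · obtain ⟨t, ht⟩ : ∃ t : ℤ, x = 4 * t + 3 := ⟨x / 4, by omega⟩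
    have hpZ : (p : ℤ) = 2 * p' + 1 := by exact_mod_cast hp'
    -- `γ = (1 − 2px, t + 2pt + 3p' + 2; −8p, 1 + 2p)`
    refine modularSymbol_div_sub_div_mem_periodLattice f (a := 1 - 2 * p * x) (b := t + 2 * p * t + 3 * p' + 2)
      (c := -8 * p) (d := 1 + 2 * p) ?_ ⟨-2, by rw [hN]; ring⟩ 1 4 x 4 (by norm_num) (by norm_num) ?_ ?_
    · rw [ht, hpZ]; ring
    · rw [hpZ]; nlinarith
    · rw [ht, hpZ]; ring

/-- **`{∞, 1/4}_f ∈ Λ_f ⟹ 2 ∣ deg φ_D`** for every `X₀(4p)`-datum `D` of every elliptic curve, `p` odd, `p ≠ 1`. -/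
theorem two_dvd_deg_of_quarterSymbol_mem {p : ℕ} [NeZero (4 * p)] (hp : Odd p) (hp1 : p ≠ 1)
    {W : WeierstrassCurve ℚ} [W.IsElliptic] (D : ModularParametrizationData W (4 * p))
    (hmem : modularSymbol D.f (1 / 4 : ℚ) ∈ periodLattice D.f) : 2 ∣ D.deg := by
  have hp0 : 0 < p := by obtain ⟨p', hp'⟩ := hp; omega
  haveI : NeZero p := ⟨hp0.ne'⟩
  have hdiv : 4 * p / p = 4 := Nat.mul_div_cancel 4 hp0
  have hcop : Nat.Coprime p (4 * p / p) := by
    rw [hdiv]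
    obtain ⟨p', hp'⟩ := hp
    have h2 : Nat.Coprime p 2 := (Nat.coprime_comm.mp (Nat.prime_two.coprime_iff_not_dvd.mpr (by omega)))
    simpa using h2.pow_right 2
  have hx : modularSymbol D.f ((atkinLehnerSL (4 * p) p 0 0 : ℚ) / (4 * p / p : ℕ)) ∈ periodLattice D.f := by
    have h := (periodLattice D.f).add_mem (modularSymbol_atkinLehnerCusp_sub_quarter_mem hp D.f) hmem
    rwa [sub_add_cancel] at h
  have h0 : D.uniformize ((D.c : ℂ) * modularSymbol D.f ((atkinLehnerSL (4 * p) p 0 0 : ℚ) / (4 * p / p : ℕ))) = 0 :=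
    (D.uniformize_eq_zero_iff _).mpr (D.smul_periodLattice_le _ hx)
  exact two_dvd_modularDegree_of_cusp_atkinLehnerW_eq_zero (dvd_mul_left p 4) hcop hp1 (by rw [hdiv]) D h0

/-- **ODD DEGREE ⟹ QUARTER SYMBOL NOT A PERIOD** (`N = 4p`, `p` odd, `p ≠ 1`; any curve, any datum). -/
theorem quarterSymbol_not_mem_of_odd_deg {p : ℕ} [NeZero (4 * p)] (hp : Odd p) (hp1 : p ≠ 1)
    {W : WeierstrassCurve ℚ} [W.IsElliptic] (D : ModularParametrizationData W (4 * p)) (hodd : Odd D.deg) :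
    modularSymbol D.f (1 / 4 : ℚ) ∉ periodLattice D.f := fun hmem =>
  (Nat.not_even_iff_odd.mpr hodd) (even_iff_two_dvd.mpr (two_dvd_deg_of_quarterSymbol_mem hp hp1 D hmem))

/-- **`OddDegreeForcesQuarterSymbol` IS A THEOREM** (an g17 leaf `OddDegreeTooth`: E-an-74 ⟹ E-an-75 on the blind family
`E′_m`, `N = 4(m² + 4)`): the family binders are not even needed — odd degree forces `{∞, 1/4}_f ∉ Λ_f` for every
`X₀(4p)`-datum, `p` odd.  BSD is not proved by this. -/
theorem oddDegreeForcesQuarterSymbol_holds : OddDegreeForcesQuarterSymbol := by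
  intro hodd m p _ _ _ D hm hpm hprime hopt
  have hmodd : Odd m := by
    rw [Int.odd_iff]; omega
  have hpodd : Odd p := by
    have h : Odd ((p : ℤ)) := by
      rw [hpm]
      obtain ⟨k, hk⟩ := hmodd
      exact ⟨2 * k ^ 2 + 2 * k + 2, by rw [hk]; ring⟩
    exact_mod_cast (Int.odd_coe_nat p).mp h
  exact quarterSymbol_not_mem_of_odd_deg hpodd hprime.one_lt.ne' D (hodd m p D hm hpm hprime hopt)

end Summit.BirchSwinnertonDyer.BirchSwinnertonDyer.Theorems.ManinLocalTwoThree

end
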